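import Literature.Analysis.PDE.ParabolicMaximumPrinciple1D
import Literature.Analysis.PDE.ParabolicHolderNorm
import Mathlib.Analysis.InnerProductSpace.PiL2
import HarnessLib

/-!
# The weak maximum principle for the heat operator on parabolic cylinders of `R^m × ℝ`

Topic `Literature/Analysis/PDE` (companion of `ParabolicMaximumPrinciple1D.lean`, which does one
space dimension, and of `ParabolicHolderNorm.lean`, whose spacetime `Parabolic E`, spatial
derivative `spaceDeriv` and time derivative `timeDeriv` we use).  For a function `u` on parabolic
spacetime over `R^m = EuclideanSpace ℝ (Fin m)`, continuous on the closed parabolic cylinder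
`Q = B̄(x₀, R) × [t₀, t₁]`, twice differentiable in space and differentiable from the left in time
at the points of the parabolic interior `B(x₀, R) × (t₀, t₁]`, with
`∂ₜ u - Δ u ≤ 0` there, we prove **the weak maximum principle**
`u ≤ max_{∂_p Q} u` (`le_of_heat_subsolution`: if `u ≤ M` on the parabolic boundary
`∂B(x₀, R) × [t₀, t₁] ∪ B̄(x₀, R) × {t₀}` then `u ≤ M` on `Q`).  Here
`Δ u (X) = Σᵢ D²u(X)(eᵢ, eᵢ)` is `Parabolic.laplacian`.  Proof (Evans, *PDE*, §7.1.3 Thm. 8 with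
`L = -Δ`, `c = 0`; Lieberman, Lemma 2.3): perturb to the strict subsolution `u - ε(t - t₀)`, take a
maximum point on the compact cylinder; at an interior maximum `D²u(eᵢ, eᵢ) ≤ 0` along every
coordinate line (`deriv_deriv_nonpos_of_isLocalMax`) and the left time derivative is `≥ 0`
(`nonneg_of_hasDerivWithinAt_Iic_of_le`), contradicting strictness; let `ε → 0`.

## References

* [Evans2010] L. C. Evans, *Partial Differential Equations*, 2nd ed., AMS 2010, §7.1.3, Thm. 8
  (weak maximum principle for parabolic operators, case `c ≡ 0`).
* [Lieberman1996] G. M. Lieberman, *Second Order Parabolic Differential Equations*, World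
  Scientific 1996, Ch. II, Lemma 2.3.
-/

noncomputable section

open Set Filter Topology Metric

namespace Literature.Analysis.PDE

namespace Parabolic

variable {m : ℕ}

/-- The **Laplacian** `Δ u (X) = Σᵢ D²u(X)(eᵢ, eᵢ)` of a function on parabolic spacetime over
`R^m` (trace of the second spatial derivative `spaceDeriv (spaceDeriv u)` in the standard
orthonormal basis). [cite: Evans2010, §7.1] -/
def laplacian (u : Parabolic (EuclideanSpace ℝ (Fin m)) → ℝ)
    (X : Parabolic (EuclideanSpace ℝ (Fin m))) : ℝ :=
  ∑ i, spaceDeriv (spaceDeriv u) X (EuclideanSpace.single i 1) (EuclideanSpace.single i 1)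

/-- Unfolding the Laplacian. [cite: Evans2010, §7.1] -/
theorem laplacian_eq (u : Parabolic (EuclideanSpace ℝ (Fin m)) → ℝ)
    (X : Parabolic (EuclideanSpace ℝ (Fin m))) :
    laplacian u X =
      ∑ i, spaceDeriv (spaceDeriv u) X (EuclideanSpace.single i 1) (EuclideanSpace.single i 1) :=
  rfl

/-- The closed parabolic cylinder `B̄(x₀, R) × [t₀, t₁]` is compact. [folklore] -/
theorem isCompact_cylinder (x₀ : EuclideanSpace ℝ (Fin m)) (R t₀ t₁ : ℝ) :
    IsCompact {X : Parabolic (EuclideanSpace ℝ (Fin m)) |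
      X.x ∈ closedBall x₀ R ∧ X.t ∈ Icc t₀ t₁} := by
  have h : {X : Parabolic (EuclideanSpace ℝ (Fin m)) | X.x ∈ closedBall x₀ R ∧ X.t ∈ Icc t₀ t₁}
      = (homeomorphProd (E := EuclideanSpace ℝ (Fin m))) ⁻¹' (closedBall x₀ R ×ˢ Icc t₀ t₁) := by
    ext X; simp
  rw [h, Homeomorph.isCompact_preimage]
  exact (isCompact_closedBall x₀ R).prod isCompact_Icc

/-- **No interior maximum for a strict subsolution** (the pointwise step): if `x ↦ u(x, τ(Z))`
is differentiable near `Z.x` with derivative `Du`, `Du` is differentiable at `Z.x` with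
derivative `D2`, `u(Z.x, ·)` has the left derivative `ut` at `τ(Z)`, and `Z` is a local spatial
maximum and a left temporal maximum of `u`, then `ut - Σᵢ D2(eᵢ, eᵢ) ≥ 0` (second-order condition
along each coordinate line, first-order condition from the left in time).
[cite: Evans2010, §7.1.3 Thm. 8] -/
theorem dt_sub_trace_nonneg_of_isMax {u : Parabolic (EuclideanSpace ℝ (Fin m)) → ℝ}
    {Z : Parabolic (EuclideanSpace ℝ (Fin m))}
    {Du : EuclideanSpace ℝ (Fin m) → EuclideanSpace ℝ (Fin m) →L[ℝ] ℝ}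
    {D2 : EuclideanSpace ℝ (Fin m) →L[ℝ] EuclideanSpace ℝ (Fin m) →L[ℝ] ℝ} {ut : ℝ}
    (hD : ∀ᶠ x in 𝓝 Z.x, HasFDerivAt (fun x' => u ⟨x', Z.t⟩) (Du x) x)
    (hD2 : HasFDerivAt Du D2 Z.x)
    (hT : HasDerivWithinAt (fun τ => u ⟨Z.x, τ⟩) ut (Iic Z.t) Z.t)
    (hmaxx : ∀ᶠ x in 𝓝 Z.x, u ⟨x, Z.t⟩ ≤ u Z) (hmaxt : ∀ᶠ τ in 𝓝[<] Z.t, u ⟨Z.x, τ⟩ ≤ u Z) :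
    0 ≤ ut - ∑ i, D2 (EuclideanSpace.single i 1) (EuclideanSpace.single i 1) := by
  -- time: the left derivative at a left maximum is nonnegative
  have ht : 0 ≤ ut := nonneg_of_hasDerivWithinAt_Iic_of_le hT hmaxt
  -- space: along every coordinate line the second derivative is nonpositive
  have hx : ∀ i : Fin m, D2 (EuclideanSpace.single i 1) (EuclideanSpace.single i 1) ≤ 0 := by
    intro i
    set e : EuclideanSpace ℝ (Fin m) := EuclideanSpace.single i 1 with he
    set ℓ : ℝ → EuclideanSpace ℝ (Fin m) := fun s => Z.x + s • e with hℓ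
    have hℓ0 : ℓ 0 = Z.x := by simp [hℓ]
    have hℓd : ∀ s, HasDerivAt ℓ e s := fun s => by
      simpa [hℓ] using ((hasDerivAt_id s).smul_const e).const_add Z.x
    have hℓc : Tendsto ℓ (𝓝 0) (𝓝 Z.x) := by
      rw [← hℓ0]; exact (hℓd 0).continuousAt.tendsto
    have hf' : ∀ᶠ s in 𝓝 (0 : ℝ), HasDerivAt (fun s => u ⟨ℓ s, Z.t⟩) (Du (ℓ s) e) s := by
      filter_upwards [hℓc.eventually hD] with s hs
      exact hs.comp_hasDerivAt s (hℓd s)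
    have hA : HasFDerivAt (fun x' => Du x' e)
        ((Du Z.x).comp (0 : EuclideanSpace ℝ (Fin m) →L[ℝ] EuclideanSpace ℝ (Fin m)) +
          D2.flip e) Z.x :=
      hD2.clm_apply (hasFDerivAt_const e Z.x)
    have hf'' : HasDerivAt (fun s => Du (ℓ s) e) (D2 e e) 0 := by
      have h := hA.comp_hasDerivAt_of_eq 0 (hℓd 0) hℓ0.symm
      simpa [Function.comp_def] using h
    have hmax : IsLocalMax (fun s => u ⟨ℓ s, Z.t⟩) 0 := by
      show ∀ᶠ s in 𝓝 (0 : ℝ), u ⟨ℓ s, Z.t⟩ ≤ u ⟨ℓ 0, Z.t⟩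
      rw [hℓ0]
      exact hℓc.eventually hmaxx
    exact deriv_deriv_nonpos_of_isLocalMax hmax hf' hf''
  have hsum : ∑ i, D2 (EuclideanSpace.single i 1) (EuclideanSpace.single i 1) ≤ 0 :=
    Finset.sum_nonpos fun i _ => hx i
  linarith

/-- **The weak maximum principle for the heat operator on a parabolic cylinder** (Evans, *PDE*
§7.1.3 Thm. 8 with `L = -Δ`, `c = 0`; Lieberman Lemma 2.3).  Let `u` be continuous on
`Q = B̄(x₀, R) × [t₀, t₁]`; at every point `X` of the parabolic interior `B(x₀, R) × (t₀, t₁]`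
let `x ↦ u(x, t)` be differentiable near `X.x` with derivative `Du(·, t)`, `Du(·, t)`
differentiable at `X.x` with derivative `D2u(X)`, and `u(X.x, ·)` differentiable from the left at
`t` with derivative `ut(X)`, and suppose `ut(X) - Σᵢ D2u(X)(eᵢ, eᵢ) ≤ 0` there.  If `u ≤ M` on the
parabolic boundary (`∂B(x₀, R) × [t₀, t₁]` and `B̄(x₀, R) × {t₀}`), then `u ≤ M` on `Q`.
[cite: Evans2010, §7.1.3 Thm. 8] -/
theorem le_of_subsolution_heat {u : Parabolic (EuclideanSpace ℝ (Fin m)) → ℝ}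
    {Du : Parabolic (EuclideanSpace ℝ (Fin m)) → EuclideanSpace ℝ (Fin m) →L[ℝ] ℝ}
    {D2u : Parabolic (EuclideanSpace ℝ (Fin m)) →
      EuclideanSpace ℝ (Fin m) →L[ℝ] EuclideanSpace ℝ (Fin m) →L[ℝ] ℝ}
    {ut : Parabolic (EuclideanSpace ℝ (Fin m)) → ℝ}
    {x₀ : EuclideanSpace ℝ (Fin m)} {R t₀ t₁ M : ℝ}
    (hu : ContinuousOn u {X | X.x ∈ closedBall x₀ R ∧ X.t ∈ Icc t₀ t₁})
    (hD : ∀ X : Parabolic (EuclideanSpace ℝ (Fin m)), X.x ∈ ball x₀ R →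
      X.t ∈ Ioc t₀ t₁ →
      ∀ᶠ x in 𝓝 X.x, HasFDerivAt (fun x' => u ⟨x', X.t⟩) (Du ⟨x, X.t⟩) x)
    (hD2 : ∀ X : Parabolic (EuclideanSpace ℝ (Fin m)), X.x ∈ ball x₀ R →
      X.t ∈ Ioc t₀ t₁ →
      HasFDerivAt (fun x' => Du ⟨x', X.t⟩) (D2u X) X.x)
    (hT : ∀ X : Parabolic (EuclideanSpace ℝ (Fin m)), X.x ∈ ball x₀ R →
      X.t ∈ Ioc t₀ t₁ →
      HasDerivWithinAt (fun τ => u ⟨X.x, τ⟩) (ut X) (Iic X.t) X.t)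
    (hL : ∀ X : Parabolic (EuclideanSpace ℝ (Fin m)), X.x ∈ ball x₀ R →
      X.t ∈ Ioc t₀ t₁ →
      ut X - ∑ i, D2u X (EuclideanSpace.single i 1) (EuclideanSpace.single i 1) ≤ 0)
    (hside : ∀ X : Parabolic (EuclideanSpace ℝ (Fin m)), X.x ∈ sphere x₀ R →
      X.t ∈ Icc t₀ t₁ →
      u X ≤ M)
    (hbot : ∀ X : Parabolic (EuclideanSpace ℝ (Fin m)), X.x ∈ closedBall x₀ R → X.t = t₀ →
      u X ≤ M)
    {X : Parabolic (EuclideanSpace ℝ (Fin m))} (hXx : X.x ∈ closedBall x₀ R)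
    (hXt : X.t ∈ Icc t₀ t₁) : u X ≤ M := by
  have ht01 : t₀ ≤ t₁ := hXt.1.trans hXt.2
  -- it suffices to bound the strict subsolutions `u - ε (t - t₀)`
  suffices key : ∀ ε : ℝ, 0 < ε → u X ≤ M + ε * (t₁ - t₀) by
    refine le_of_forall_pos_le_add fun δ hδ => ?_
    rcases eq_or_lt_of_le ht01 with h | h
    · have h1 := key 1 one_pos
      rw [← h, sub_self, mul_zero, add_zero] at h1
      linarith
    · have h1 := key (δ / (t₁ - t₀)) (div_pos hδ (sub_pos.2 h))
      rwa [div_mul_cancel₀ _ (sub_pos.2 h).ne'] at h1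
  intro ε hε
  set v : Parabolic (EuclideanSpace ℝ (Fin m)) → ℝ := fun Y => u Y - ε * (Y.t - t₀) with hv
  have hvc : ContinuousOn v {Y | Y.x ∈ closedBall x₀ R ∧ Y.t ∈ Icc t₀ t₁} :=
    hu.sub ((continuous_const.mul (continuous_t.sub continuous_const)).continuousOn)
  obtain ⟨Z, hZQ, hZmax⟩ := (isCompact_cylinder x₀ R t₀ t₁).exists_isMaxOn ⟨X, hXx, hXt⟩ hvc
  -- the maximum value of `v` is at most `M`
  have hvZ : v Z ≤ M := by
    by_cases hZt : Z.t = t₀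
    · have h1 : v Z = u Z := by simp [hv, hZt]
      rw [h1]
      exact hbot Z hZQ.1 hZt
    by_cases hZs : Z.x ∈ sphere x₀ R
    · have h1 : v Z ≤ u Z := by
        simp only [hv, sub_le_self_iff]
        exact mul_nonneg hε.le (sub_nonneg.2 hZQ.2.1)
      exact h1.trans (hside Z hZs hZQ.2)
    -- otherwise `Z` is in the parabolic interior, where `v` is a strict subsolution with a
    -- spatial maximum and a left temporal maximum: contradiction
    exfalso
    have hZb : Z.x ∈ ball x₀ R := by
      have h1 : dist Z.x x₀ ≤ R := mem_closedBall.1 hZQ.1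
      exact mem_ball.2 (lt_of_le_of_ne h1 fun h => hZs (mem_sphere.2 h))
    have hZI : Z.t ∈ Ioc t₀ t₁ := ⟨lt_of_le_of_ne hZQ.2.1 (Ne.symm hZt), hZQ.2.2⟩
    have hvD : ∀ᶠ x in 𝓝 Z.x,
        HasFDerivAt (fun x' => v ⟨x', Z.t⟩) (Du ⟨x, Z.t⟩) x := by
      have hfun : (fun x' => v ⟨x', Z.t⟩) = fun x' => u ⟨x', Z.t⟩ - ε * (Z.t - t₀) := rfl
      rw [hfun]
      filter_upwards [hD Z hZb hZI] with x hx using hx.sub_const _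
    have hvT : HasDerivWithinAt (fun τ => v ⟨Z.x, τ⟩) (ut Z - ε) (Iic Z.t) Z.t := by
      have h1 : HasDerivWithinAt (fun τ : ℝ => ε * (τ - t₀)) ε (Iic Z.t) Z.t := by
        simpa using (((hasDerivAt_id Z.t).sub_const t₀).const_mul ε).hasDerivWithinAt
      exact (hT Z hZb hZI).sub h1
    have hmaxx : ∀ᶠ x in 𝓝 Z.x, v ⟨x, Z.t⟩ ≤ v Z := by
      filter_upwards [isOpen_ball.mem_nhds hZb] with x hx
      exact hZmax ⟨ball_subset_closedBall hx, hZQ.2⟩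
    have hmaxt : ∀ᶠ τ in 𝓝[<] Z.t, v ⟨Z.x, τ⟩ ≤ v Z := by
      filter_upwards [Ioo_mem_nhdsLT hZI.1] with τ hτ
      exact hZmax ⟨hZQ.1, hτ.1.le, hτ.2.le.trans hZQ.2.2⟩
    have key := dt_sub_trace_nonneg_of_isMax hvD (hD2 Z hZb hZI) hvT hmaxx hmaxt
    have hLZ := hL Z hZb hZI
    linarith
  -- conclusion from the bound on the maximum
  have h1 : v X ≤ v Z := hZmax ⟨hXx, hXt⟩
  have h2 : v X = u X - ε * (X.t - t₀) := rfl
  have h3 : ε * (X.t - t₀) ≤ ε * (t₁ - t₀) := by gcongr; exact hXt.2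
  linarith

/-- **The weak maximum principle for `∂ₜ - Δ`**, in the vocabulary of `ParabolicHolderNorm.lean`
(`spaceDeriv`, `timeDeriv`, `laplacian`): the case `Du = D u`, `D2u = D² u`, `ut = ∂ₜ u` of
`le_of_subsolution_heat` (for `u` differentiable in time at interior points, the two-sided time
derivative `timeDeriv` is in particular a left derivative). [cite: Evans2010, §7.1.3 Thm. 8] -/
theorem le_of_heat_subsolution {u : Parabolic (EuclideanSpace ℝ (Fin m)) → ℝ}
    {x₀ : EuclideanSpace ℝ (Fin m)} {R t₀ t₁ M : ℝ}
    (hu : ContinuousOn u {X | X.x ∈ closedBall x₀ R ∧ X.t ∈ Icc t₀ t₁})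
    (hD : ∀ X : Parabolic (EuclideanSpace ℝ (Fin m)), X.x ∈ ball x₀ R →
      X.t ∈ Ioc t₀ t₁ →
      ∀ᶠ x in 𝓝 X.x, HasFDerivAt (fun x' => u ⟨x', X.t⟩) (spaceDeriv u ⟨x, X.t⟩) x)
    (hD2 : ∀ X : Parabolic (EuclideanSpace ℝ (Fin m)), X.x ∈ ball x₀ R →
      X.t ∈ Ioc t₀ t₁ →
      HasFDerivAt (fun x' => spaceDeriv u ⟨x', X.t⟩) (spaceDeriv (spaceDeriv u) X) X.x)
    (hT : ∀ X : Parabolic (EuclideanSpace ℝ (Fin m)), X.x ∈ ball x₀ R →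
      X.t ∈ Ioc t₀ t₁ →
      HasDerivWithinAt (fun τ => u ⟨X.x, τ⟩) (timeDeriv u X) (Iic X.t) X.t)
    (hL : ∀ X : Parabolic (EuclideanSpace ℝ (Fin m)), X.x ∈ ball x₀ R →
      X.t ∈ Ioc t₀ t₁ →
      timeDeriv u X - laplacian u X ≤ 0)
    (hside : ∀ X : Parabolic (EuclideanSpace ℝ (Fin m)), X.x ∈ sphere x₀ R →
      X.t ∈ Icc t₀ t₁ →
      u X ≤ M)
    (hbot : ∀ X : Parabolic (EuclideanSpace ℝ (Fin m)), X.x ∈ closedBall x₀ R → X.t = t₀ →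
      u X ≤ M)
    {X : Parabolic (EuclideanSpace ℝ (Fin m))} (hXx : X.x ∈ closedBall x₀ R)
    (hXt : X.t ∈ Icc t₀ t₁) : u X ≤ M :=
  le_of_subsolution_heat (Du := spaceDeriv u) (D2u := spaceDeriv (spaceDeriv u))
    (ut := timeDeriv u) hu hD hD2 hT hL hside hbot hXx hXt

/-- **Comparison form**: under the same regularity, if `∂ₜ u - Δ u ≤ 0` in the parabolic interior
and `u ≤ 0` on the parabolic boundary then `u ≤ 0` on the cylinder; in particular two solutions of
the heat equation with the same parabolic boundary values coincide (apply to `± (u₁ - u₂)`).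
[cite: Evans2010, §7.1.3 Thm. 8–9] -/
theorem nonpos_of_heat_subsolution {u : Parabolic (EuclideanSpace ℝ (Fin m)) → ℝ}
    {x₀ : EuclideanSpace ℝ (Fin m)} {R t₀ t₁ : ℝ}
    (hu : ContinuousOn u {X | X.x ∈ closedBall x₀ R ∧ X.t ∈ Icc t₀ t₁})
    (hD : ∀ X : Parabolic (EuclideanSpace ℝ (Fin m)), X.x ∈ ball x₀ R →
      X.t ∈ Ioc t₀ t₁ →
      ∀ᶠ x in 𝓝 X.x, HasFDerivAt (fun x' => u ⟨x', X.t⟩) (spaceDeriv u ⟨x, X.t⟩) x)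
    (hD2 : ∀ X : Parabolic (EuclideanSpace ℝ (Fin m)), X.x ∈ ball x₀ R →
      X.t ∈ Ioc t₀ t₁ →
      HasFDerivAt (fun x' => spaceDeriv u ⟨x', X.t⟩) (spaceDeriv (spaceDeriv u) X) X.x)
    (hT : ∀ X : Parabolic (EuclideanSpace ℝ (Fin m)), X.x ∈ ball x₀ R →
      X.t ∈ Ioc t₀ t₁ →
      HasDerivWithinAt (fun τ => u ⟨X.x, τ⟩) (timeDeriv u X) (Iic X.t) X.t)
    (hL : ∀ X : Parabolic (EuclideanSpace ℝ (Fin m)), X.x ∈ ball x₀ R →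
      X.t ∈ Ioc t₀ t₁ →
      timeDeriv u X - laplacian u X ≤ 0)
    (hside : ∀ X : Parabolic (EuclideanSpace ℝ (Fin m)), X.x ∈ sphere x₀ R →
      X.t ∈ Icc t₀ t₁ →
      u X ≤ 0)
    (hbot : ∀ X : Parabolic (EuclideanSpace ℝ (Fin m)), X.x ∈ closedBall x₀ R → X.t = t₀ →
      u X ≤ 0)
    {X : Parabolic (EuclideanSpace ℝ (Fin m))} (hXx : X.x ∈ closedBall x₀ R)
    (hXt : X.t ∈ Icc t₀ t₁) : u X ≤ 0 :=
  le_of_heat_subsolution hu hD hD2 hT hL hside hbot hXx hXt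

end Parabolic

end Literature.Analysis.PDE
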